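import Literature.Computability.AlgebraicComplexity.OrbitMultiplicitySemigroup
import Literature.Computability.AlgebraicComplexity.StandardFamiliesProofs
import HarnessLib

/-!
# Multiplicity OBSTRUCTIONS are inherited exactly along first-row lengthening of constant
# plethysm coefficient; the stable range in general size

Topic `Literature/Computability/AlgebraicComplexity` (geometric complexity theory); proofs file
(theorems only: no definitions, no named facts). Companion of `OrbitMultiplicitySemigroup.lean`
§§6–8 (equations propagate one for one; transfer of exact multiplicities along an occurring weight
of constant ambient multiplicity; the stable range `λ₂ + |λ̄| ≤ d`). Honest framing of the cell
served (`pub-gct-max`, HOME `run/shared/lean/pub/pub-gct-max/`): multiplicity data and certified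
rank bounds at small parameters; occurrence obstructions are ruled out in print (BIP 2019) —
multiplicity obstructions are the open door; nothing here is a claim on VP ≠ VNP or P ≠ NP.

1. `plethysmCoeff_eq_plethysmCoeff_lowerTop_of_stable` — the general-size form of
   `plethysmCoeff_lowerTop_eq_of_stable`: `GL_{N²}` on forms of degree `s ≠ 0` in the `N × N`
   matrix variables over `ℂ`, `λ ⊢ D = d·s` with at most `N²` parts, `λ₂ + |λ̄| ≤ k'`,
   `k' + j = d`, `μ = lowerTop λ (s j) ⊢ D'`: `a_{λ^*} = a_{μ^*}` (BIP 2019 Prop. 5.8(2), the tree's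
   `bip2019_prop_5_8_2_holds`, counted; Landsberg 2017 Thm. 8.9.1.1). The sizes `D`, `D'` are free
   (hypotheses `D = d·s`, `D' + s j = D`), so the statement applies to partitions typed
   `Nat.Partition (m * d)` as in the certificate coordinates of `PerDetMultiplicityObstruction.lean`.
2. `orbitMultiplicity_eq_orbitMultiplicity_lowerTop_of_stable`,
   `finrank_hwv_inf_orbitVanishingIdeal_eq_lowerTop_of_stable` — for EVERY nonzero form `f` of
   degree `s`, closure multiplicity and equation count of `ℂ[Δ_s(f)]` agree at `λ^*` and `μ^*` in
   that range (transfer, `orbitMultiplicity_lowerTop_eq_of_plethysmCoeff_le`).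
3. `isMultiplicityObstructionAt_add_iff_of_plethysmCoeff_le` — for a pair of forms `(f, g)`: if
   `ψ` occurs in both `k[Δ_m(f)]` and `k[Δ_m(g)]` and `a_{χ+ψ} ≤ a_χ`, then `χ + ψ` is a
   multiplicity obstruction against `g ∈ Δ_m(f)` iff `χ` is (`IsMultiplicityObstructionAt`,
   `ObstructionTypes.lean`; Bläser–Ikenmeyer 2025 §12.4, Dörfler–Ikenmeyer–Panova 2020 §2).
4. `perDetMultiplicityObstructionAt_iff_lowerTop` — determinant versus padded permanent in the
   certificate coordinates `(n, m, d, λ)` (`PerDetMultiplicityObstructionAt`,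
   `PerDetMultiplicityObstruction.lean`), characteristic zero: if `a_{λ^*} ≤ a_{μ^*}` for
   `μ = lowerTop λ (m j) ⊢ m·d'`, then `(n, m, d, λ)` is a multiplicity obstruction iff
   `(n, m, d', μ)` is — both closure multiplicities copy, and `det_m ≠ 0`, `X₀₀^{m−n} per_n ≠ 0`.
5. `perDetMultiplicityObstructionAt_iff_lowerTop_of_stable` — over `ℂ`, unconditionally in the
   stable range `λ₂ + |λ̄| ≤ d' ≤ d`: the obstruction question for the body `λ̄` (with second row
   `λ₂`) against `det_m` is DECIDED at degree `|λ̄| + λ₂`; no new multiplicity obstruction for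
   `X₀₀^{m−n} per_n ∉ Δ(det_m)` can appear further out along the first row. (The kernel form of the
   scan bookkeeping "LEMMA S + Q0(d)" of the cell, with BIP's printed threshold.)

## References

* P. Bürgisser, C. Ikenmeyer, G. Panova, *No occurrence obstructions in geometric complexity
  theory*, J. AMS 32 (2019) = arXiv:1604.06431v3, §4.4 (outer degree lifting), §5(c) Prop. 5.8(2).
  [BurgisserIkenmeyerPanovaJAMS2019]
* M. Bläser, C. Ikenmeyer, *Introduction to Geometric Complexity Theory*, Theory of Computing
  Graduate Surveys 10 (2025), §12.4 (multiplicity obstructions), Prop. 21.17 (semigroup property).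
  [BlaeserIkenmeyer2025]
* J. Dörfler, C. Ikenmeyer, G. Panova, *On geometric complexity theory: Multiplicity obstructions
  are stronger than occurrence obstructions*, SIAM J. Appl. Algebra Geom. 4 (2020), §2 (2.2), §5.
  [DorflerIkenmeyerPanova2020]
* J. M. Landsberg, *Geometry and Complexity Theory*, CUP (2017), §8.9.1 Thm. 8.9.1.1.
  [LandsbergGCT2017]

## Mathlib and tree

Tree: `bip2019_prop_5_8_2_holds`, `lowerTop`, `card_parts_lowerTop_le`, `topDegIdx`
(`PlethysmStabilityBIP.lean`, `OccurrenceObstructionsBIP.lean`);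
`orbitMultiplicity_lowerTop_eq_of_plethysmCoeff_le`,
`finrank_hwv_inf_orbitVanishingIdeal_lowerTop_eq_of_plethysmCoeff_le`, `plethysmCoeff_lowerTop_le`,
`partitionWeightLex_lowerTop_add_nsmul_single`, `orbitMultiplicity_add_eq_of_plethysmCoeff_le`
(`OrbitMultiplicitySemigroup.lean`); `IsMultiplicityObstructionAt` (`ObstructionTypes.lean`);
`PerDetMultiplicityObstructionAt` (`PerDetMultiplicityObstruction.lean`); `detFormLex_isHomogeneous`,
`paddedPerFormLex_isHomogeneous` (`SchurWeylPlethysm.lean`), `Complexity.detFormLex_ne_zero`,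
`perPoly_ne_zero` (`StandardFamiliesProofs.lean`), `monWeight_eq_of_mem_weightSpace`,
`isHomogeneous_of_mem_highestWeightSpace` (`PlethysmLifting.lean`). Mathlib:
`LinearMap.finrank_le_finrank_of_surjective`, `MvPolynomial.rename_injective`.
-/

noncomputable section

open MvPolynomial

namespace Literature.Computability.AlgebraicComplexity

open _root_.Literature.NumberTheory.DiophantineGeometry
open _root_.Literature.Computability.Complexity

/-! ### 0. Plumbing -/

/-- The size of `λ^* = partitionWeightLex N λ` is `-|λ|` when `λ` has at most `N²` parts.
[cite: BurgisserIkenmeyerPanovaJAMS2019, §3(b)] -/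
private theorem size_partitionWeightLex_of_card_le {N D : ℕ} (lam : Nat.Partition D)
    (hlam : lam.parts.card ≤ N * N) : (partitionWeightLex N lam).size = -(D : ℤ) := by
  rw [partitionWeightLex, Weight.size_toMatIdx, Weight.dualOfPartition, Weight.size_dual,
    Weight.size_ofPartition_holds hlam]

/-- A nonzero vector lies in at most one highest-weight space of `k[Sym^m]`.
[cite: BurgisserEtAl2011, §4.4] -/
private theorem weight_eq_of_mem_highestWeightSpace_of_ne_zero {σ k : Type*} [Fintype σ]
    [LinearOrder σ] [Field k] [Infinite k] {m : ℕ} {χ χ' : Weight σ}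
    {F : MvPolynomial (DegIdx σ m) k} (hF : F ∈ highestWeightSpace (coordRep σ k m) χ)
    (hF' : F ∈ highestWeightSpace (coordRep σ k m) χ') (hF0 : F ≠ 0) : χ = χ' := by
  classical
  obtain ⟨s, hs⟩ := MvPolynomial.support_nonempty.mpr hF0
  rw [← monWeight_eq_of_mem_weightSpace (highestWeightSpace_le_weightSpace _ _ hF) hs,
    ← monWeight_eq_of_mem_weightSpace (highestWeightSpace_le_weightSpace _ _ hF') hs]

/-- The padded permanent `X₀₀^{m-n} per_n` (lexicographic matrix variables) is a nonzero
polynomial over any field (`per_n ≠ 0`, `perPoly_ne_zero`; `rename` along injections is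
injective). [folklore] -/
private theorem paddedPerFormLex_ne_zero' (K : Type) [Field K] (n m : ℕ) [NeZero m] :
    paddedPerFormLex K n m ≠ 0 := by
  have hinj : Function.Injective
      (fun ij : BlockIdx n m × BlockIdx n m => ((ij.1 : Fin m), (ij.2 : Fin m))) := by
    intro a b h
    simp only [Prod.mk.injEq] at h
    exact Prod.ext (Subtype.ext h.1) (Subtype.ext h.2)
  have hper : rename (fun ij : BlockIdx n m × BlockIdx n m => ((ij.1 : Fin m), (ij.2 : Fin m)))
      (perPoly (BlockIdx n m) K) ≠ 0 := fun h =>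
    perPoly_ne_zero (BlockIdx n m) K (rename_injective _ hinj (by rw [h, map_zero]))
  have hpad : paddedPerPoly K n m ≠ 0 := mul_ne_zero (pow_ne_zero _ (X_ne_zero _)) hper
  intro h
  exact hpad (rename_injective _ toLex.injective (by
    rw [← paddedPerFormLex.eq_1]
    rw [h, map_zero]))

/-! ### 1. The stable range in general size -/

/-- **Plethysm stability counted, general size (BIP 2019 Prop. 5.8(2) as an equality).**
`GL_{N²}` on forms of degree `s ≠ 0` in the `N × N` matrix variables over `ℂ`; `λ ⊢ D = d·s` with
at most `N²` parts, `λ₂ + |λ̄| ≤ k'`, `k' + j = d`, and `μ = lowerTop λ (s j) ⊢ D'` (`D' + s j = D`;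
`μ̄ = λ̄`, first row shortened by `s j`). Then `a_{λ^*} = a_{μ^*}`: "`≥`" is the injectivity of
the outer degree lifting `g ↦ (e_1^s)^j · g` (`plethysmCoeff_lowerTop_le`), "`≤`" its surjectivity
onto `HWV_{λ^*}` in this range — BIP Prop. 5.8(2): "Suppose that `f` is a highest weight vector in
`Sym^d Sym^m V` of weight `μ ⊢ dm` and assume that `μ₂ + |μ̄| ≤ k ≤ d` for some `k`. Then
`μ = ν♯dm` for some `ν ⊢ mk` and `f = (e_1^m)^{d-k} · g` for some `g ∈ HWV_ν(Sym^k Sym^m V)`"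
(tree `bip2019_prop_5_8_2_holds`). Same proof as `plethysmCoeff_lowerTop_eq_of_stable`, with the
sizes `D`, `D'` kept free. [cite: BurgisserIkenmeyerPanovaJAMS2019, Prop. 5.8(2)] -/
theorem plethysmCoeff_eq_plethysmCoeff_lowerTop_of_stable {N s : ℕ} [NeZero N] (hs : s ≠ 0)
    {D D' d k' j : ℕ} (hDd : D = d * s) (hj : k' + j = d) (lam : Nat.Partition D)
    (hlam : lam.parts.card ≤ N * N) (hk : secondPart lam + bodySize lam ≤ k')
    (hD : D' + s * j = D) (hr : secondPart lam + s * j ≤ lam.parts.sup) :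
    plethysmCoeff ℂ (MatIdx N) s (partitionWeightLex N lam) =
      plethysmCoeff ℂ (MatIdx N) s (partitionWeightLex N (lowerTop lam (s * j) D' hD hr)) := by
  classical
  subst hDd
  have hkd : k' ≤ d := by omega
  have hdk : d - k' = j := by omega
  refine le_antisymm ?_ (plethysmCoeff_lowerTop_le (k := ℂ) hs lam j hD hr)
  set nu := lowerTop lam (s * j) D' hD hr with hnu
  set ψ : Weight (MatIdx N) := Pi.single (topMatIdx N) (-(s : ℤ)) with hψ
  have hw : partitionWeightLex N nu + j • ψ = partitionWeightLex N lam :=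
    partitionWeightLex_lowerTop_add_nsmul_single (N := N) lam j hD hr
  haveI : FiniteDimensional ℂ (highestWeightSpace (coordRep (MatIdx N) ℂ s)
      (partitionWeightLex N nu)) :=
    finiteDimensional_highestWeightSpace_coordRep_holds hs _
  have hX : (X (topDegIdx N s) : MvPolynomial (DegIdx (MatIdx N) s) ℂ) ^ j ∈
      highestWeightSpace (coordRep (MatIdx N) ℂ s) (j • ψ) :=
    pow_mem_highestWeightSpace_coordRep
      (X_mem_highestWeightSpace_coordRep (k := ℂ) s (topMatIdx N) (le_topMatIdx N)
        (topDegIdx N s) rfl) j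
  let L : ↥(highestWeightSpace (coordRep (MatIdx N) ℂ s) (partitionWeightLex N nu)) →ₗ[ℂ]
      ↥(highestWeightSpace (coordRep (MatIdx N) ℂ s) (partitionWeightLex N lam)) :=
    { toFun := fun g => ⟨g.1 * X (topDegIdx N s) ^ j, by
        have h := mul_mem_highestWeightSpace_coordRep g.2 hX
        rwa [hw] at h⟩
      map_add' := fun a b => by
        ext
        simp [add_mul]
      map_smul' := fun c a => by
        ext
        simp }
  have hL : Function.Surjective L := by
    rintro ⟨f, hf⟩
    by_cases hf0 : f = 0
    · refine ⟨0, Subtype.ext ?_⟩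
      simp [L, hf0]
    have hfd : f.IsHomogeneous d :=
      isHomogeneous_of_mem_highestWeightSpace hs hf
        (by rw [size_partitionWeightLex_of_card_le lam hlam, Nat.mul_comm])
    obtain ⟨nu', g, _hnu', _hbody, _hgd, hgw, hfg⟩ :=
      bip2019_prop_5_8_2_holds N s d k' lam hlam hk hkd f hfd hf
    rw [hdk] at hfg
    have hg0 : g ≠ 0 := by
      rintro rfl
      exact hf0 (by rw [hfg, mul_zero])
    have hfw' : f ∈ highestWeightSpace (coordRep (MatIdx N) ℂ s)
        (j • ψ + partitionWeightLex N nu') := by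
      rw [hfg]
      exact mul_mem_highestWeightSpace_coordRep hX hgw
    have hwt : partitionWeightLex N nu' = partitionWeightLex N nu := by
      have h1 := weight_eq_of_mem_highestWeightSpace_of_ne_zero hf hfw' hf0
      rw [← hw, add_comm] at h1
      exact (add_left_cancel h1).symm
    refine ⟨⟨g, hwt ▸ hgw⟩, Subtype.ext ?_⟩
    change g * X (topDegIdx N s) ^ j = f
    rw [hfg, mul_comm]
  exact LinearMap.finrank_le_finrank_of_surjective hL

/-- **Closure multiplicities are frozen in the stable range, general size**: for EVERY nonzero
form `f` of degree `s ≠ 0` in the `N × N` matrix variables over `ℂ`, with `λ, μ, k', j` as in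
`plethysmCoeff_eq_plethysmCoeff_lowerTop_of_stable` (`λ₂ + |λ̄| ≤ k'`, `k' + j = d`):
`mult_{λ^*} ℂ[Δ_s(f)] = mult_{μ^*} ℂ[Δ_s(f)]`. [cite: BurgisserIkenmeyerPanovaJAMS2019, Prop. 5.8(2)] -/
theorem orbitMultiplicity_eq_orbitMultiplicity_lowerTop_of_stable {N s : ℕ} [NeZero N]
    (hs : s ≠ 0) {f : MvPolynomial (MatIdx N) ℂ} (hf : f.IsHomogeneous s) (hf0 : f ≠ 0)
    {D D' d k' j : ℕ} (hDd : D = d * s) (hj : k' + j = d) (lam : Nat.Partition D)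
    (hlam : lam.parts.card ≤ N * N) (hk : secondPart lam + bodySize lam ≤ k')
    (hD : D' + s * j = D) (hr : secondPart lam + s * j ≤ lam.parts.sup) :
    orbitMultiplicity ℂ f s (partitionWeightLex N lam) =
      orbitMultiplicity ℂ f s (partitionWeightLex N (lowerTop lam (s * j) D' hD hr)) :=
  orbitMultiplicity_lowerTop_eq_of_plethysmCoeff_le hs hf hf0 lam j hD hr
    (plethysmCoeff_eq_plethysmCoeff_lowerTop_of_stable hs hDd hj lam hlam hk hD hr).le

/-- … and so are the EQUATION COUNTS `dim (HWV ∩ I(GL·f))` (general size).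
[cite: BurgisserIkenmeyerPanovaJAMS2019, Prop. 5.8(2)] -/
theorem finrank_hwv_inf_orbitVanishingIdeal_eq_lowerTop_of_stable {N s : ℕ} [NeZero N]
    (hs : s ≠ 0) {f : MvPolynomial (MatIdx N) ℂ} (hf : f.IsHomogeneous s) (hf0 : f ≠ 0)
    {D D' d k' j : ℕ} (hDd : D = d * s) (hj : k' + j = d) (lam : Nat.Partition D)
    (hlam : lam.parts.card ≤ N * N) (hk : secondPart lam + bodySize lam ≤ k')
    (hD : D' + s * j = D) (hr : secondPart lam + s * j ≤ lam.parts.sup) :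
    Module.finrank ℂ ↥(highestWeightSpace (coordRep (MatIdx N) ℂ s) (partitionWeightLex N lam) ⊓
        (orbitVanishingIdeal f s).restrictScalars ℂ) =
      Module.finrank ℂ ↥(highestWeightSpace (coordRep (MatIdx N) ℂ s)
        (partitionWeightLex N (lowerTop lam (s * j) D' hD hr)) ⊓
        (orbitVanishingIdeal f s).restrictScalars ℂ) :=
  finrank_hwv_inf_orbitVanishingIdeal_lowerTop_eq_of_plethysmCoeff_le hs hf hf0 lam j hD hr
    (plethysmCoeff_eq_plethysmCoeff_lowerTop_of_stable hs hDd hj lam hlam hk hD hr).le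

/-! ### 2. Transfer of multiplicity OBSTRUCTIONS -/

section General

variable {σ k : Type} [Fintype σ] [LinearOrder σ] [Field k]

/-- **Multiplicity obstructions are inherited exactly along an occurring weight of constant
ambient multiplicity.** For a pair of forms `(f, g)`, `m ≠ 0`, characteristic zero: if `ψ` occurs
in both `k[Δ_m(f)]` and `k[Δ_m(g)]` and `a_{χ+ψ} ≤ a_χ`, then `χ + ψ` is a multiplicity obstruction
against `g ∈ Δ_m(f)` (`mult_{χ+ψ} k[Δ_m(f)] < mult_{χ+ψ} k[Δ_m(g)]`, Bläser–Ikenmeyer §12.4) iff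
`χ` is: both multiplicities copy (`orbitMultiplicity_add_eq_of_plethysmCoeff_le`).
[cite: BlaeserIkenmeyer2025, §12.4] -/
theorem isMultiplicityObstructionAt_add_iff_of_plethysmCoeff_le [CharZero k]
    {f g : MvPolynomial σ k} {m : ℕ} (hm : m ≠ 0) (χ : Weight σ) {ψ : Weight σ}
    (hψf : HasHighestWeight (orbitCoordRep f m) ψ) (hψg : HasHighestWeight (orbitCoordRep g m) ψ)
    (ha : plethysmCoeff k σ m (χ + ψ) ≤ plethysmCoeff k σ m χ) :
    IsMultiplicityObstructionAt f g m (χ + ψ) ↔ IsMultiplicityObstructionAt f g m χ := by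
  unfold IsMultiplicityObstructionAt
  rw [orbitMultiplicity_add_eq_of_plethysmCoeff_le f hm χ hψf ha,
    orbitMultiplicity_add_eq_of_plethysmCoeff_le g hm χ hψg ha]

/-- First-row form: for nonzero forms `f, g` of degree `m ≠ 0` (so that `X_{x_{iₘ}^m}` occurs in
both coordinate rings) and `a_{χ + n·(−m ε_{iₘ})} ≤ a_χ`, the type `χ + n·(−m ε_{iₘ})` is a
multiplicity obstruction against `g ∈ Δ_m(f)` iff `χ` is. [cite: BlaeserIkenmeyer2025, §12.4] -/
theorem isMultiplicityObstructionAt_add_nsmul_single_top_iff [CharZero k]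
    {f g : MvPolynomial σ k} {m : ℕ} (hm : m ≠ 0) (hf : f.IsHomogeneous m) (hf0 : f ≠ 0)
    (hg : g.IsHomogeneous m) (hg0 : g ≠ 0) (iₘ : σ) (hiₘ : ∀ i, i ≤ iₘ) (χ : Weight σ) (n : ℕ)
    (ha : plethysmCoeff k σ m (χ + n • Pi.single iₘ (-(m : ℤ))) ≤ plethysmCoeff k σ m χ) :
    IsMultiplicityObstructionAt f g m (χ + n • Pi.single iₘ (-(m : ℤ))) ↔
      IsMultiplicityObstructionAt f g m χ := by
  unfold IsMultiplicityObstructionAt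
  rw [orbitMultiplicity_add_nsmul_single_top_eq_of_plethysmCoeff_le hm hf hf0 iₘ hiₘ χ n ha,
    orbitMultiplicity_add_nsmul_single_top_eq_of_plethysmCoeff_le hm hg hg0 iₘ hiₘ χ n ha]

end General

/-! ### 3. Determinant versus padded permanent, certificate coordinates `(n, m, d, λ)` -/

section PerDet

variable {K : Type} [Field K]

/-- **Transfer of per-versus-det multiplicity obstructions along the first row.** Characteristic
zero, `λ ⊢ m·d` with at most `m²` parts, `λ₂ + m j ≤ λ₁`, `μ = lowerTop λ (m j) ⊢ m·d'`; if the
plethysm coefficient is not raised by the lengthening, `a_{λ^*} ≤ a_{μ^*}` (e.g.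
`a_λ(d[m]) = a_μ(d'[m])`), then `(n, m, d, λ)` is a multiplicity obstruction
(`mult_{λ^*} K[Δ(det_m)] < mult_{λ^*} K[Δ(X₀₀^{m−n} per_n)]`) iff `(n, m, d', μ)` is one: both
closure multiplicities are inherited exactly (`orbitMultiplicity_lowerTop_eq_of_plethysmCoeff_le`
for the nonzero forms `det_m` and `X₀₀^{m−n} per_n`). In particular no NEW obstruction appears at a
scan row whose plethysm coefficient equals that of its first-row shortening.
[cite: BlaeserIkenmeyer2025, §12.4] -/
theorem perDetMultiplicityObstructionAt_iff_lowerTop [CharZero K] {n m d d' j : ℕ} [NeZero m]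
    (lam : Nat.Partition (m * d)) (hlam : lam.parts.card ≤ m * m)
    (hD : m * d' + m * j = m * d) (hr : secondPart lam + m * j ≤ lam.parts.sup)
    (ha : plethysmCoeff K (MatIdx m) m (partitionWeightLex m lam) ≤
      plethysmCoeff K (MatIdx m) m (partitionWeightLex m (lowerTop lam (m * j) (m * d') hD hr))) :
    PerDetMultiplicityObstructionAt (k := K) n m d lam ↔
      PerDetMultiplicityObstructionAt (k := K) n m d' (lowerTop lam (m * j) (m * d') hD hr) := by
  have hm : m ≠ 0 := NeZero.ne m
  have hdet := orbitMultiplicity_lowerTop_eq_of_plethysmCoeff_le (k := K) hm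
    (detFormLex_isHomogeneous K m) (detFormLex_ne_zero m) lam j hD hr ha
  have hcard := card_parts_lowerTop_le lam (m * j) (m * d') hD hr
  constructor
  · rintro ⟨_, hnm, hlt⟩
    have hper := orbitMultiplicity_lowerTop_eq_of_plethysmCoeff_le (k := K) hm
      (paddedPerFormLex_isHomogeneous K hnm) (paddedPerFormLex_ne_zero' K n m) lam j hD hr ha
    refine ⟨hcard.trans hlam, hnm, ?_⟩
    unfold IsMultiplicityObstructionAt at hlt ⊢
    rw [← hdet, ← hper]
    exact hlt
  · rintro ⟨_, hnm, hlt⟩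
    have hper := orbitMultiplicity_lowerTop_eq_of_plethysmCoeff_le (k := K) hm
      (paddedPerFormLex_isHomogeneous K hnm) (paddedPerFormLex_ne_zero' K n m) lam j hD hr ha
    refine ⟨hlam, hnm, ?_⟩
    unfold IsMultiplicityObstructionAt at hlt ⊢
    rw [hdet, hper]
    exact hlt

/-- **The obstruction question for a body is decided at degree `|λ̄| + λ₂` (over `ℂ`,
unconditionally).** `λ ⊢ m·d` with at most `m²` parts, `λ₂ + |λ̄| ≤ d'`, `d' + j = d`,
`μ = lowerTop λ (m j) ⊢ m·d'` (same body, first row shorter by `m j`): `(n, m, d, λ)` is a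
multiplicity obstruction for `X₀₀^{m−n} per_n ∉ Δ(det_m)` iff `(n, m, d', μ)` is — the plethysm
coefficient is constant there by BIP 2019 Prop. 5.8(2)
(`plethysmCoeff_eq_plethysmCoeff_lowerTop_of_stable`), so
`perDetMultiplicityObstructionAt_iff_lowerTop` applies. Hence along every body the search for
multiplicity obstructions is finite: nothing new happens beyond the printed stability threshold.
[cite: BurgisserIkenmeyerPanovaJAMS2019, Prop. 5.8(2)] -/
theorem perDetMultiplicityObstructionAt_iff_lowerTop_of_stable {n m d d' j : ℕ} [NeZero m]
    (lam : Nat.Partition (m * d)) (hlam : lam.parts.card ≤ m * m)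
    (hk : secondPart lam + bodySize lam ≤ d') (hj : d' + j = d)
    (hD : m * d' + m * j = m * d) (hr : secondPart lam + m * j ≤ lam.parts.sup) :
    PerDetMultiplicityObstructionAt (k := ℂ) n m d lam ↔
      PerDetMultiplicityObstructionAt (k := ℂ) n m d' (lowerTop lam (m * j) (m * d') hD hr) :=
  perDetMultiplicityObstructionAt_iff_lowerTop lam hlam hD hr
    (plethysmCoeff_eq_plethysmCoeff_lowerTop_of_stable (N := m) (NeZero.ne m) (Nat.mul_comm m d)
      hj lam hlam hk hD hr).le

end PerDet

end Literature.Computability.AlgebraicComplexity
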